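import Summits.KontsevichZagierPeriods.KontsevichZagierPeriods.Theses.HurwitzMicroSectors
import Summits.KontsevichZagierPeriods.KontsevichZagierPeriods.Theorems.HurwitzMicroSectorsNormalFormPrinciplePiBoxTransfer
import Summits.KontsevichZagierPeriods.KontsevichZagierPeriods.Theorems.HurwitzMicroSectorsNormalFormPrincipleVariants2320
import Summits.KontsevichZagierPeriods.KontsevichZagierPeriods.Theorems.HurwitzMicroSectorsNormalFormPrincipleVariants2284
import Summits.KontsevichZagierPeriods.KontsevichZagierPeriods.Theorems.HurwitzMicroSectorsNormalFormPrincipleVariants2287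

/-! TTRL-lite variant V2290 of stmt-KontsevichZagierPeriods-3869

Variant V2290 = `stub_boxRigidity` (the leaf `BoxRigidity` of `NormalFormPrinciple`: two BOX-RATIONAL
representations — domain the open unit box, integrand `p/q` over `ℚ` — with equal values are
KZ-equivalent) under the move `fix_nat:m=5; bound_nat:m'≤4` (left dimension frozen to `5`, right
dimension `≤ 4`). Verdict of the attempt seat: **open** — this file is the exact-strength certificate,
not a proof of the variant. With `BoxVanishing K` := "every box-rational representation of dimension
`K` and value `0` is a relation":
* `V2290 ⟺ BoxVanishing 5` (`stub_boxRigidity_var2290_iff_boxVanishing_five`), the instance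
  `K = 5, b = 4` of the tree's `boxRigidityFixBound_iff_boxVanishing` (forward: `m' = 0`, compare with
  the zero representation on the `0`-box; backward: pad to `(0,1)⁵` by unit intervals and subtract);
* hence `V2290 ⟺ BoxRigidity for all m, m' ≤ 5` (`stub_boxRigidity_var2290_iff_le_five`) and V2290
  coincides with its siblings V2287 (`m' ≤ 3`) and V2284 (`m' ≤ 2`): the bound on `m'` is idle
  (`stub_boxRigidity_var2290_iff_var2287`, `stub_boxRigidity_var2290_iff_var2284`);
* `KontsevichZagierPeriods ⟹ parent leaf ⟹ V2290` (`stub_boxRigidity_var2290_of_statement`,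
  `stub_boxRigidity_var2290_of_parent`), so a refutation of V2290 would refute the Summit; the tree
  has no invariant of `KZ.relations` finer than `eval` (soundness) with which to attempt one.
Why open: `BoxVanishing 5 ⟹ BoxVanishing 2` (`boxVanishing_le_five_of_stub_boxRigidity_var2290`),
which contains the Catalan family `[(0,1)², 1/(1+x²y²) − c]` (`c : ℚ`, value `G − c`): a chain of
moves at `c` forces `G = c` by soundness, so a proof must refute `G = c` for all but at most one
rational `c` — an irrationality-type theorem for `G`, open; dimension `5` adds `ζ(5)`, `π²ζ(3)`.
The tree's knowledge stops at `m, m' ≤ 1` (`boxRigidity_of_le_one`, Baker). Residual goal: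
`BoxVanishing 5`. Source: M. Kontsevich, D. Zagier, *Periods* (2001), §1.2 Conjecture 1.
Pure proof file, no definitions. -/

-- `Summit.<Summit>.<Problem>` is the tree's mandated summit-side namespace (CONVENTIONS §2); for this
-- single-conjunct summit the two coincide, so the duplicate is deliberate.
set_option linter.dupNamespace false

noncomputable section

namespace Summit.KontsevichZagierPeriods.KontsevichZagierPeriods.Theorems

open MeasureTheory Set
open Literature.NumberTheory.Transcendental Literature.NumberTheory.Transcendental.KZ
open Summit.KontsevichZagierPeriods.KontsevichZagierPeriods.Theses.HurwitzMicroSectors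
open Summit.KontsevichZagierPeriods.HurwitzMicroSectors.NormalFormPrinciple.PiBox

/-! ## The variant V2290 is exactly `BoxVanishing 5` -/

/-- **V2290 ⟺ BoxVanishing in dimension `5`** (every box-rational representation on `(0,1)⁵` of value
`0` is a KZ relation): instance `K = 5`, `b = 4` of `boxRigidityFixBound_iff_boxVanishing`.
[cite: KontsevichZagier2001, §1.2 Conjecture 1] -/
theorem stub_boxRigidity_var2290_iff_boxVanishing_five :
    (∀ (m' : ℕ) (N : IntegralRep 5) (N' : IntegralRep m'), m' ≤ 4 → N.domain = {x | ∀ i, x i ∈ Set.Ioo (0:ℝ) 1} → N.IsRational → N'.domain = {x | ∀ i, x i ∈ Set.Ioo (0:ℝ) 1} → N'.IsRational → N.value = N'.value → Equivalent N N') ↔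
    (∀ (N : IntegralRep 5), N.domain = {x | ∀ i, x i ∈ Set.Ioo (0:ℝ) 1} → N.IsRational →
      N.value = 0 → of N ∈ relations) :=
  boxRigidityFixBound_iff_boxVanishing (by norm_num)

/-- **V2290 ⟺ BoxRigidity under the joint bound `m, m' ≤ 5`** (the honest strength of the variant:
Conjecture 1 for all pairs of rational integrands on the open unit boxes of dimension at most `5`).
[cite: KontsevichZagier2001, §1.2 Conjecture 1] -/
theorem stub_boxRigidity_var2290_iff_le_five :
    (∀ (m' : ℕ) (N : IntegralRep 5) (N' : IntegralRep m'), m' ≤ 4 → N.domain = {x | ∀ i, x i ∈ Set.Ioo (0:ℝ) 1} → N.IsRational → N'.domain = {x | ∀ i, x i ∈ Set.Ioo (0:ℝ) 1} → N'.IsRational → N.value = N'.value → Equivalent N N') ↔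
    (∀ (m m' : ℕ) (N : IntegralRep m) (N' : IntegralRep m'), m ≤ 5 → m' ≤ 5 →
      N.domain = {x | ∀ i, x i ∈ Set.Ioo (0:ℝ) 1} → N.IsRational →
      N'.domain = {x | ∀ i, x i ∈ Set.Ioo (0:ℝ) 1} → N'.IsRational →
      N.value = N'.value → Equivalent N N') := by
  rw [stub_boxRigidity_var2290_iff_boxVanishing_five, ← stub_boxRigidity_var2284_iff_boxVanishing_five]
  exact stub_boxRigidity_var2284_iff_le_five

/-- **V2290 ⟺ V2287** (the sibling `fix_nat:m=5; bound_nat:m'≤3`): both are `BoxVanishing 5`, the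
bound on `m'` is idle. [cite: KontsevichZagier2001, §1.2 Conjecture 1] -/
theorem stub_boxRigidity_var2290_iff_var2287 :
    (∀ (m' : ℕ) (N : IntegralRep 5) (N' : IntegralRep m'), m' ≤ 4 → N.domain = {x | ∀ i, x i ∈ Set.Ioo (0:ℝ) 1} → N.IsRational → N'.domain = {x | ∀ i, x i ∈ Set.Ioo (0:ℝ) 1} → N'.IsRational → N.value = N'.value → Equivalent N N') ↔
    (∀ (m' : ℕ) (N : IntegralRep 5) (N' : IntegralRep m'), m' ≤ 3 → N.domain = {x | ∀ i, x i ∈ Set.Ioo (0:ℝ) 1} → N.IsRational → N'.domain = {x | ∀ i, x i ∈ Set.Ioo (0:ℝ) 1} → N'.IsRational → N.value = N'.value → Equivalent N N') := by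
  rw [stub_boxRigidity_var2290_iff_boxVanishing_five, stub_boxRigidity_var2287_iff_boxVanishing_five]

/-- **V2290 ⟺ V2284** (the sibling `fix_nat:m=5; bound_nat:m'≤2`): both are `BoxVanishing 5`.
[cite: KontsevichZagier2001, §1.2 Conjecture 1] -/
theorem stub_boxRigidity_var2290_iff_var2284 :
    (∀ (m' : ℕ) (N : IntegralRep 5) (N' : IntegralRep m'), m' ≤ 4 → N.domain = {x | ∀ i, x i ∈ Set.Ioo (0:ℝ) 1} → N.IsRational → N'.domain = {x | ∀ i, x i ∈ Set.Ioo (0:ℝ) 1} → N'.IsRational → N.value = N'.value → Equivalent N N') ↔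
    (∀ (m' : ℕ) (N : IntegralRep 5) (N' : IntegralRep m'), m' ≤ 2 → N.domain = {x | ∀ i, x i ∈ Set.Ioo (0:ℝ) 1} → N.IsRational → N'.domain = {x | ∀ i, x i ∈ Set.Ioo (0:ℝ) 1} → N'.IsRational → N.value = N'.value → Equivalent N N') := by
  rw [stub_boxRigidity_var2290_iff_boxVanishing_five, stub_boxRigidity_var2284_iff_boxVanishing_five]

/-- **V2290 ⇒ BoxVanishing in every dimension `≤ 5`**, in particular the dimension-`2` statement that
every vanishing absolutely convergent `∫∫_{(0,1)²} p/q` (`p/q ∈ ℚ(x, y)`) is generated by the four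
moves — the first open level (Catalan / dilogarithm relations). [cite: KontsevichZagier2001, §1.2 Conjecture 1] -/
theorem boxVanishing_le_five_of_stub_boxRigidity_var2290
    (h : ∀ (m' : ℕ) (N : IntegralRep 5) (N' : IntegralRep m'), m' ≤ 4 → N.domain = {x | ∀ i, x i ∈ Set.Ioo (0:ℝ) 1} → N.IsRational → N'.domain = {x | ∀ i, x i ∈ Set.Ioo (0:ℝ) 1} → N'.IsRational → N.value = N'.value → Equivalent N N')
    {j : ℕ} (hj : j ≤ 5) (N : IntegralRep j) (hNd : N.domain = {x | ∀ i, x i ∈ Set.Ioo (0:ℝ) 1})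
    (hNr : N.IsRational) (hv : N.value = 0) : of N ∈ relations :=
  boxVanishing_le_five_of_boxVanishing_five (stub_boxRigidity_var2290_iff_boxVanishing_five.1 h) hj N
    hNd hNr hv

/-! ## Upper bounds: the parent leaf and the Summit imply V2290 -/

/-- **The parent leaf ⇒ V2290** (specialisation `m := 5`; the hypothesis `m' ≤ 4` is dropped).
[cite: KontsevichZagier2001, §1.2 Conjecture 1] -/
theorem stub_boxRigidity_var2290_of_parent
    (h : ∀ (m m' : ℕ) (N : IntegralRep m) (N' : IntegralRep m'), N.domain = {x | ∀ i, x i ∈ Set.Ioo (0:ℝ) 1} → N.IsRational → N'.domain = {x | ∀ i, x i ∈ Set.Ioo (0:ℝ) 1} → N'.IsRational → N.value = N'.value → Equivalent N N') :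
    ∀ (m' : ℕ) (N : IntegralRep 5) (N' : IntegralRep m'), m' ≤ 4 → N.domain = {x | ∀ i, x i ∈ Set.Ioo (0:ℝ) 1} → N.IsRational → N'.domain = {x | ∀ i, x i ∈ Set.Ioo (0:ℝ) 1} → N'.IsRational → N.value = N'.value → Equivalent N N' :=
  fun m' N N' _ => h 5 m' N N'

/-- **`KontsevichZagierPeriods ⇒ V2290`**: the variant is a special case of Conjecture 1 for the
tree's calculus (`leaves_of_statement`) — so a refutation of the variant would refute the Summit.
[cite: KontsevichZagier2001, §1.2 Conjecture 1] -/
theorem stub_boxRigidity_var2290_of_statement (h : _root_.KontsevichZagierPeriods) :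
    ∀ (m' : ℕ) (N : IntegralRep 5) (N' : IntegralRep m'), m' ≤ 4 → N.domain = {x | ∀ i, x i ∈ Set.Ioo (0:ℝ) 1} → N.IsRational → N'.domain = {x | ∀ i, x i ∈ Set.Ioo (0:ℝ) 1} → N'.IsRational → N.value = N'.value → Equivalent N N' :=
  stub_boxRigidity_var2290_of_parent (leaves_of_statement h).1

end Summit.KontsevichZagierPeriods.KontsevichZagierPeriods.Theorems

end
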